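import Literature.NumberTheory.K2Lit.SiegelStandardExtension
import Summits.HodgeConjecture.HodgeConjecture.Theorems.K2LiuStdFamilyFactorisablePrelims

/-!
# A standard family right-invariant under `K^S_H` factorises off `S` (socket #31s of hLiu418's LOCAL SEAM of s23)

Track B ∕ K2-LIT, hLiu418 = stmt-HodgeConjecture-24832; pays socket #31s `sig_K2LiuStdFamilyFactorisable` of
`Cruxes/HLiu418/Lines/K2_Liu_CurveThetaSigs_U5d_ZetaS.lean` (ED. 1 :156) BY NAME: `stdFamilyFactorisable` has the socket's statement
verbatim. THE HECKE BYPASS'S SECTION SIDE (LS3): for a standard family `f` (★ `IsStandardSectionFamily`) right-invariant under `K^S_H ⊆ 𝒦.K`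
at one parameter, (i) `f_s` is right-`K^S_H`-invariant for every `s` (★ `IsStandardSectionFamily.apply_delta_mul` + the Iwasawa decomposition of
`𝒦`), (ii) `f_s(h) = f_s(h_∞, h_S, 1^S) · ∏ᶠ_{v∉S} Λ_{s,v}(h_v)` (★ `IsFactorizableOff`): write `h = P·(h_{∞S}·k^S)` with `P = ∏_{v∈T} ι_v(p_v) ∈ P_Δ(𝔸)`
over the finite set `T` of places `v ∉ S` where `h_v ∉ K_{H,v}` (`h_v = p_v k_v` by the local Iwasawa hypothesis), `h_{∞S} = placesEmbed(h_∞, h_S)`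
(★ `placesEmbed`), `k^S ∈ K^S_H`; then the section law, (i), ★ `siegelDeltaCharacter_mul` ∕ ★ `siegelCharLoc_apply` and ★ `lambdaLoc_mul_eq` ∕
★ `lambdaLoc_of_mem_localInt`. Component bookkeeping through ★ `UnitaryGroupPlaceInclusion` (`evalPlace_inclPlace`, `eq_of_forall_evalPlace_eq`),
★ `UnitaryGroupAdelicProduct` (`archPart ∕ finPart ∕ adelicProdEquiv`), ★ `splitPlaces_placesEmbedFin`.
[Liu2011, §2B p. 862]; [GelbartPiatetskishapiroRallis1987, Part A §1]; [Tan1999, §1]; [BorelJacquet1979, §4.1]. Theorems only; no `sorry`.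
HONEST LABEL: HC_CM is proved only modulo the printed citations (2 remaining named inputs: hLiu418 = stmt-HodgeConjecture-24832, h413 =
stmt-HodgeConjecture-24833) until rung 0 closes; this file pays one tier-1 support socket and moves no counter by itself.
-/

set_option autoImplicit false

set_option linter.dupNamespace false

noncomputable section

open scoped RestrictedProduct
open NumberField IsDedekindDomain

namespace Summit.HodgeConjecture.HodgeConjecture.Cruxes.HLiu418.K2LiuStdFamilyFactorisable

open Literature.NumberTheory.K2Lit.PlaceSplitting
open Literature.NumberTheory.Automorphic Literature.NumberTheory.GaloisRepresentations
open Literature.NumberTheory.GelbartRogawski1991 Literature.NumberTheory.GelbartRogawski1991.GRConstruction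
open Literature.NumberTheory.K2Lit.SiegelDoubled

/-! ## The theorem (kit: ★ `K2LiuStdFamilyFactorisablePrelims`) -/

set_option maxHeartbeats 1000000 in -- measured: > 800 000 < 1 000 000 (the doubled unitary datum's 40-binder telescope + adelic component bookkeeping); plain `rw`/`exact`, no search tactics
/-- **A STANDARD FAMILY RIGHT-INVARIANT UNDER `K^S_H` FACTORISES OFF `S`** — socket #31s `sig_K2LiuStdFamilyFactorisable` verbatim (organ (LS3)(c) of
the local seam of s23): (i) right-`K^S_H`-invariance at every parameter, (ii) `f_s(h) = f_s(placesEmbed(h_∞, h_S)) · ∏ᶠ_{v∉S} Λ_{s,v}(h_v)`.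
[cite: Liu2011, §2B p. 862] [cite: GelbartPiatetskishapiroRallis1987, Part A §1] [cite: Tan1999, §1] [cite: KudlaRallis1994, §1] [cite: BorelJacquet1979, §4.1] -/
theorem stdFamilyFactorisable :
    ∀ (L : Type) [Field L] [NumberField L] [IsCMField L] {N M n : ℕ} (e : Fin N × Fin M ≃ Fin n)
      (dV : Fin N → L) (hdV : ∀ i, IsCMField.complexConj L (dV i) = dV i) (_hdV0 : ∀ i, dV i ≠ 0)
      (dW : Fin M → L) (hdW : ∀ i, IsCMField.complexConj L (dW i) = dW i) (_hdW0 : ∀ i, dW i ≠ 0)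
      (S : Finset (HeightOneSpectrum (𝓞 (Fp L)))) [DecidableEq (HeightOneSpectrum (𝓞 (Fp L)))]
      (χ : HeckeCharacter L) (_hχ : ∀ v, v ∉ S → ∀ w' : UnitaryGroup.PlacesOver L v, χ.IsUnramifiedAt w'.1)
      -- local Iwasawa decomposition at every `v ∉ S` (by value, as #31p)
      (_hIw : ∀ v, v ∉ S → ∀ x : UnitaryGroup.localPi L (IsCMField.complexConj L) (n + n) (hermD L e dV hdV dW hdW) v,
        ∃ p ∈ siegelDeltaLoc L e dV hdV dW hdW v,
          ∃ k ∈ UnitaryGroup.localInt L (IsCMField.complexConj L) (n + n) (hermD L e dV hdV dW hdW) v, x = p * k)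
      (𝒦 : IwasawaDatum L e dV hdV dW hdW) (f : ℂ → HA L e dV hdV dW hdW → ℂ) (_hf : IsStandardSectionFamily 𝒦 χ f)
      -- `K^S_H ⊆ 𝒦.K` (#31p ∕ #33s)
      (_hK : ∀ k : HA L e dV hdV dW hdW,
        UnitaryGroup.archPart (Fp L) L (IsCMField.complexConj L) (n + n) (hermD L e dV hdV dW hdW) k = 1 →
        (∀ v, UnitaryGroup.evalPlace (Fp L) L (IsCMField.complexConj L) (n + n) (hermD L e dV hdV dW hdW) v
            (UnitaryGroup.finPart (Fp L) L (IsCMField.complexConj L) (n + n) (hermD L e dV hdV dW hdW) k) ∈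
          UnitaryGroup.localInt L (IsCMField.complexConj L) (n + n) (hermD L e dV hdV dW hdW) v) →
        (∀ v ∈ S, UnitaryGroup.evalPlace (Fp L) L (IsCMField.complexConj L) (n + n) (hermD L e dV hdV dW hdW) v
            (UnitaryGroup.finPart (Fp L) L (IsCMField.complexConj L) (n + n) (hermD L e dV hdV dW hdW) k) = 1) →
        k ∈ 𝒦.K)
      -- right-`K^S_H`-invariance at ONE parameter `s₀`
      (s₀ : ℂ)
      (_hR : ∀ h k : HA L e dV hdV dW hdW,
        UnitaryGroup.archPart (Fp L) L (IsCMField.complexConj L) (n + n) (hermD L e dV hdV dW hdW) k = 1 →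
        (∀ v, UnitaryGroup.evalPlace (Fp L) L (IsCMField.complexConj L) (n + n) (hermD L e dV hdV dW hdW) v
            (UnitaryGroup.finPart (Fp L) L (IsCMField.complexConj L) (n + n) (hermD L e dV hdV dW hdW) k) ∈
          UnitaryGroup.localInt L (IsCMField.complexConj L) (n + n) (hermD L e dV hdV dW hdW) v) →
        (∀ v ∈ S, UnitaryGroup.evalPlace (Fp L) L (IsCMField.complexConj L) (n + n) (hermD L e dV hdV dW hdW) v
            (UnitaryGroup.finPart (Fp L) L (IsCMField.complexConj L) (n + n) (hermD L e dV hdV dW hdW) k) = 1) →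
        f s₀ (h * k) = f s₀ h),
      (∀ (s : ℂ) (h k : HA L e dV hdV dW hdW),
        UnitaryGroup.archPart (Fp L) L (IsCMField.complexConj L) (n + n) (hermD L e dV hdV dW hdW) k = 1 →
        (∀ v, UnitaryGroup.evalPlace (Fp L) L (IsCMField.complexConj L) (n + n) (hermD L e dV hdV dW hdW) v
            (UnitaryGroup.finPart (Fp L) L (IsCMField.complexConj L) (n + n) (hermD L e dV hdV dW hdW) k) ∈
          UnitaryGroup.localInt L (IsCMField.complexConj L) (n + n) (hermD L e dV hdV dW hdW) v) →
        (∀ v ∈ S, UnitaryGroup.evalPlace (Fp L) L (IsCMField.complexConj L) (n + n) (hermD L e dV hdV dW hdW) v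
            (UnitaryGroup.finPart (Fp L) L (IsCMField.complexConj L) (n + n) (hermD L e dV hdV dW hdW) k) = 1) →
        f s (h * k) = f s h) ∧
      IsFactorizableOff L e dV hdV dW hdW S χ f
        (fun s x => f s (placesEmbed L (hermD L e dV hdV dW hdW) S x)) := by
  intro L _ _ _ N M n e dV hdV hdV0 dW hdW hdW0 S _ χ hχ hIw 𝒦 f hf hK s₀ hR
  classical
  /- ### (i) right-`K^S_H`-invariance at every parameter -/
  have hRall : ∀ (s : ℂ) (h k : HA L e dV hdV dW hdW),
      UnitaryGroup.archPart (Fp L) L (IsCMField.complexConj L) (n + n) (hermD L e dV hdV dW hdW) k = 1 →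
      (∀ v, UnitaryGroup.evalPlace (Fp L) L (IsCMField.complexConj L) (n + n) (hermD L e dV hdV dW hdW) v
          (UnitaryGroup.finPart (Fp L) L (IsCMField.complexConj L) (n + n) (hermD L e dV hdV dW hdW) k) ∈
        UnitaryGroup.localInt L (IsCMField.complexConj L) (n + n) (hermD L e dV hdV dW hdW) v) →
      (∀ v ∈ S, UnitaryGroup.evalPlace (Fp L) L (IsCMField.complexConj L) (n + n) (hermD L e dV hdV dW hdW) v
          (UnitaryGroup.finPart (Fp L) L (IsCMField.complexConj L) (n + n) (hermD L e dV hdV dW hdW) k) = 1) →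
      f s (h * k) = f s h := by
    intro s h k h1 h2 h3
    have hkK : k ∈ 𝒦.K := hK k h1 h2 h3
    obtain ⟨p, k₀, hp, hk₀, rfl⟩ := 𝒦.iwasawa h
    rw [mul_assoc, hf.apply_delta_mul s s₀ hp (mul_mem hk₀ hkK), hR k₀ k h1 h2 h3, ← hf.apply_delta_mul s s₀ hp hk₀]
  refine ⟨hRall, fun s h => ?_⟩
  beta_reduce
  /- ### (ii) `h∞S = placesEmbed (h_∞, h_S)` (opaque) and its components -/
  obtain ⟨hE, hhEdef⟩ : ∃ hE : HA L e dV hdV dW hdW, hE = placesEmbed L (hermD L e dV hdV dW hdW) S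
      (UnitaryGroup.archPart (Fp L) L (IsCMField.complexConj L) (n + n) (hermD L e dV hdV dW hdW) h, fun v : S => UnitaryGroup.evalPlace (Fp L) L (IsCMField.complexConj L)
          (n + n) (hermD L e dV hdV dW hdW) v.1 (UnitaryGroup.finPart (Fp L) L (IsCMField.complexConj L) (n + n) (hermD L e dV hdV dW hdW) h)) := ⟨_, rfl⟩
  rw [← hhEdef]
  have hE_arch : UnitaryGroup.archPart (Fp L) L (IsCMField.complexConj L) (n + n) (hermD L e dV hdV dW hdW) hE = UnitaryGroup.archPart (Fp L) L (IsCMField.complexConj L)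
      (n + n) (hermD L e dV hdV dW hdW) h := by
    rw [hhEdef]; exact archPart_placesEmbed L e dV hdV dW hdW S _ _
  have hE_S : ∀ v (hv : v ∈ S), UnitaryGroup.evalPlace (Fp L) L (IsCMField.complexConj L) (n + n) (hermD L e dV hdV dW hdW) v (UnitaryGroup.finPart (Fp L) L
      (IsCMField.complexConj L) (n + n) (hermD L e dV hdV dW hdW) hE) = UnitaryGroup.evalPlace (Fp L) L (IsCMField.complexConj L) (n + n) (hermD L e dV hdV dW hdW) v
      (UnitaryGroup.finPart (Fp L) L (IsCMField.complexConj L) (n + n) (hermD L e dV hdV dW hdW) h) := by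
    intro v hv; rw [hhEdef]; exact evalPlace_finPart_placesEmbed_of_mem L e dV hdV dW hdW S _ _ v hv
  have hE_off : ∀ v (hv : v ∉ S), UnitaryGroup.evalPlace (Fp L) L (IsCMField.complexConj L) (n + n) (hermD L e dV hdV dW hdW) v (UnitaryGroup.finPart (Fp L) L
      (IsCMField.complexConj L) (n + n) (hermD L e dV hdV dW hdW) hE) = 1 := by
    intro v hv; rw [hhEdef]; exact evalPlace_finPart_placesEmbed_of_not_mem L e dV hdV dW hdW S _ _ v hv
  /- ### local decompositions off `S` and the exceptional finite set `T` -/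
  have hdec : ∀ v : {v : HeightOneSpectrum (𝓞 (Fp L)) // v ∉ S}, ∃ p ∈ siegelDeltaLoc L e dV hdV dW hdW v.1,
      ∃ k ∈ UnitaryGroup.localInt L (IsCMField.complexConj L) (n + n) (hermD L e dV hdV dW hdW) v.1,
        UnitaryGroup.evalPlace (Fp L) L (IsCMField.complexConj L) (n + n) (hermD L e dV hdV dW hdW) v.1
          (UnitaryGroup.finPart (Fp L) L (IsCMField.complexConj L) (n + n) (hermD L e dV hdV dW hdW) h) = p * k := fun v => hIw v.1 v.2 _
  choose p hp k hk hpk using hdec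
  have hfin : {v : {v : HeightOneSpectrum (𝓞 (Fp L)) // v ∉ S} |
      UnitaryGroup.evalPlace (Fp L) L (IsCMField.complexConj L) (n + n) (hermD L e dV hdV dW hdW) v.1
        (UnitaryGroup.finPart (Fp L) L (IsCMField.complexConj L) (n + n) (hermD L e dV hdV dW hdW) h) ∉
      UnitaryGroup.localInt L (IsCMField.complexConj L) (n + n) (hermD L e dV hdV dW hdW) v.1}.Finite :=
    (Filter.eventually_cofinite.1 (UnitaryGroup.eventually_evalPlace_mem_localInt (Fp L) L (IsCMField.complexConj L) (n + n)
      (hermD L e dV hdV dW hdW) (UnitaryGroup.finPart (Fp L) L (IsCMField.complexConj L) (n + n) (hermD L e dV hdV dW hdW) h))).preimage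
      Subtype.val_injective.injOn
  set T := hfin.toFinset with hTdef
  have hT : ∀ v : {v : HeightOneSpectrum (𝓞 (Fp L)) // v ∉ S}, v ∈ T ↔
      UnitaryGroup.evalPlace (Fp L) L (IsCMField.complexConj L) (n + n) (hermD L e dV hdV dW hdW) v.1
        (UnitaryGroup.finPart (Fp L) L (IsCMField.complexConj L) (n + n) (hermD L e dV hdV dW hdW) h) ∉
      UnitaryGroup.localInt L (IsCMField.complexConj L) (n + n) (hermD L e dV hdV dW hdW) v.1 := fun v => by
    rw [hTdef, Set.Finite.mem_toFinset]; rfl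
  obtain ⟨P, hPΔ, hPa, hPT, hPoff, hPχ⟩ := exists_siegelDelta_prod L e dV hdV dW hdW S χ s p hp T
  /- ### `k^S := P⁻¹ (h∞S⁻¹ h)` lies in `K^S_H` -/
  obtain ⟨kS, hkSdef⟩ : ∃ kS : HA L e dV hdV dW hdW, kS = P⁻¹ * (hE⁻¹ * h) := ⟨_, rfl⟩
  have hk1 : UnitaryGroup.archPart (Fp L) L (IsCMField.complexConj L) (n + n) (hermD L e dV hdV dW hdW) kS = 1 := by
    rw [hkSdef]
    exact map_conj_eq_one (fun x : HA L e dV hdV dW hdW => UnitaryGroup.archPart (Fp L) L (IsCMField.complexConj L) (n + n) (hermD L e dV hdV dW hdW) x) (archPart_mul' L e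
        dV hdV dW hdW) (archPart_inv' L e dV hdV dW hdW) hPa hE_arch
  have hk3 : ∀ v ∈ S, UnitaryGroup.evalPlace (Fp L) L (IsCMField.complexConj L) (n + n) (hermD L e dV hdV dW hdW) v
      (UnitaryGroup.finPart (Fp L) L (IsCMField.complexConj L) (n + n) (hermD L e dV hdV dW hdW) kS) = 1 := by
    intro v hv
    rw [hkSdef]
    exact map_conj_eq_one (fun x : HA L e dV hdV dW hdW => UnitaryGroup.evalPlace (Fp L) L (IsCMField.complexConj L) (n + n) (hermD L e dV hdV dW hdW) v
        (UnitaryGroup.finPart (Fp L) L (IsCMField.complexConj L) (n + n) (hermD L e dV hdV dW hdW) x)) (evalPlace_finPart_mul' L e dV hdV dW hdW v)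
      (evalPlace_finPart_inv' L e dV hdV dW hdW v) (hPoff v fun ⟨hv', _⟩ => hv' hv) (hE_S v hv)
  have hk2 : ∀ v, UnitaryGroup.evalPlace (Fp L) L (IsCMField.complexConj L) (n + n) (hermD L e dV hdV dW hdW) v
      (UnitaryGroup.finPart (Fp L) L (IsCMField.complexConj L) (n + n) (hermD L e dV hdV dW hdW) kS) ∈
      UnitaryGroup.localInt L (IsCMField.complexConj L) (n + n) (hermD L e dV hdV dW hdW) v := by
    intro v
    by_cases hv : v ∈ S
    · rw [hk3 v hv]; exact one_mem _
    · by_cases hvT : (⟨v, hv⟩ : {v : HeightOneSpectrum (𝓞 (Fp L)) // v ∉ S}) ∈ T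
      · have h1 : UnitaryGroup.evalPlace (Fp L) L (IsCMField.complexConj L) (n + n) (hermD L e dV hdV dW hdW) v (UnitaryGroup.finPart (Fp L) L (IsCMField.complexConj L) (n
          + n) (hermD L e dV hdV dW hdW) P) = p ⟨v, hv⟩ := hPT _ hvT
        have h3 : UnitaryGroup.evalPlace (Fp L) L (IsCMField.complexConj L) (n + n) (hermD L e dV hdV dW hdW) v (UnitaryGroup.finPart (Fp L) L (IsCMField.complexConj L) (n
            + n) (hermD L e dV hdV dW hdW) h) = p ⟨v, hv⟩ * k ⟨v, hv⟩ := hpk ⟨v, hv⟩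
        have h4 : UnitaryGroup.evalPlace (Fp L) L (IsCMField.complexConj L) (n + n) (hermD L e dV hdV dW hdW) v (UnitaryGroup.finPart (Fp L) L (IsCMField.complexConj L) (n
            + n) (hermD L e dV hdV dW hdW) kS) = k ⟨v, hv⟩ := by
          rw [hkSdef]
          exact map_conj_eq_of (fun x : HA L e dV hdV dW hdW => UnitaryGroup.evalPlace (Fp L) L (IsCMField.complexConj L) (n + n) (hermD L e dV hdV dW hdW) v
              (UnitaryGroup.finPart (Fp L) L (IsCMField.complexConj L) (n + n) (hermD L e dV hdV dW hdW) x)) (evalPlace_finPart_mul' L e dV hdV dW hdW v)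
            (evalPlace_finPart_inv' L e dV hdV dW hdW v) h1 (hE_off v hv) h3
        rw [h4]; exact hk ⟨v, hv⟩
      · have h4 : UnitaryGroup.evalPlace (Fp L) L (IsCMField.complexConj L) (n + n) (hermD L e dV hdV dW hdW) v (UnitaryGroup.finPart (Fp L) L (IsCMField.complexConj L) (n
          + n) (hermD L e dV hdV dW hdW) kS) = UnitaryGroup.evalPlace (Fp L) L (IsCMField.complexConj L) (n + n) (hermD L e dV hdV dW hdW) v (UnitaryGroup.finPart (Fp L) L
          (IsCMField.complexConj L) (n + n) (hermD L e dV hdV dW hdW) h) := by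
          rw [hkSdef]
          exact map_conj_eq_self (fun x : HA L e dV hdV dW hdW => UnitaryGroup.evalPlace (Fp L) L (IsCMField.complexConj L) (n + n) (hermD L e dV hdV dW hdW) v
              (UnitaryGroup.finPart (Fp L) L (IsCMField.complexConj L) (n + n) (hermD L e dV hdV dW hdW) x)) (evalPlace_finPart_mul' L e dV hdV dW hdW v)
            (evalPlace_finPart_inv' L e dV hdV dW hdW v) (hPoff v fun ⟨hv', hm⟩ => hvT hm) (hE_off v hv)
        rw [h4]; exact not_not.1 ((hT ⟨v, hv⟩).not.1 hvT)
  /- ### `h = P · (h∞S · k^S)` (the finitely supported `P` commutes with `h∞S`) -/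
  have hcomm : hE * P = P * hE := by
    refine eq_of_archPart_eq_of_finPart_eq L e dV hdV dW hdW _ _ ?_ ?_
    · exact map_comm_of_eq_one (fun x : HA L e dV hdV dW hdW => UnitaryGroup.archPart (Fp L) L (IsCMField.complexConj L) (n + n) (hermD L e dV hdV dW hdW) x)
        (archPart_mul' L e dV hdV dW hdW) hPa
    · refine UnitaryGroup.eq_of_forall_evalPlace_eq (Fp L) L (IsCMField.complexConj L) (n + n) (hermD L e dV hdV dW hdW) fun v => ?_
      by_cases hv : v ∈ S
      · exact map_comm_of_eq_one (fun x : HA L e dV hdV dW hdW => UnitaryGroup.evalPlace (Fp L) L (IsCMField.complexConj L) (n + n) (hermD L e dV hdV dW hdW) v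
          (UnitaryGroup.finPart (Fp L) L (IsCMField.complexConj L) (n + n) (hermD L e dV hdV dW hdW) x)) (evalPlace_finPart_mul' L e dV hdV dW hdW v)
          (hPoff v fun ⟨hv', _⟩ => hv' hv)
      · exact (map_comm_of_eq_one (fun x : HA L e dV hdV dW hdW => UnitaryGroup.evalPlace (Fp L) L (IsCMField.complexConj L) (n + n) (hermD L e dV hdV dW hdW) v
          (UnitaryGroup.finPart (Fp L) L (IsCMField.complexConj L) (n + n) (hermD L e dV hdV dW hdW) x)) (evalPlace_finPart_mul' L e dV hdV dW hdW v)
          (hE_off v hv)).symm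
  have hfac : h = P * (hE * kS) := by
    rw [hkSdef]
    exact eq_mul_mul_conj h hcomm
  /- ### the section law, (i), and the local factors -/
  conv_lhs => rw [hfac, (hf.1.1 s) P hPΔ (hE * kS), hRall s hE kS hk1 hk2 hk3, hPχ, mul_comm]
  show f s hE * ∏ v ∈ T, siegelCharLoc L e dV hdV dW hdW v.1 χ s (p v) = f s hE * _
  congr 1
  symm
  rw [finprod_eq_prod_of_mulSupport_subset _ (s := T) ?_]
  · refine Finset.prod_congr rfl fun v _ => ?_
    rw [hpk v, lambdaLoc_mul_eq L e dV hdV dW hdW v.1 χ s (hχ v.1 v.2) (hp v) (hk v)]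
  · intro v hv
    rw [Function.mem_mulSupport] at hv
    rw [Finset.mem_coe, hT]
    intro hmem
    exact hv (lambdaLoc_of_mem_localInt L e dV hdV dW hdW v.1 χ s (hχ v.1 v.2) hmem)

end Summit.HodgeConjecture.HodgeConjecture.Cruxes.HLiu418.K2LiuStdFamilyFactorisable

end
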